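import Mathlib.Algebra.Order.Chebyshev
import Mathlib.Algebra.Order.BigOperators.Group.Finset
import Mathlib.Data.Real.Basic
import Mathlib.Tactic.Linarith
import Mathlib.Tactic.Ring
import Mathlib.Tactic.Positivity
import HarnessLib

/-!
# Route `UnitScaleTilt`, crux K1 child «MinimiserStabilityRegPr» (stmt-QuantumFields-19200) — route-R E′, S3 K-form engine: THE PATH-MULTIPLICITY CAUCHY–SCHWARZ BRICK
# `Σ_q w_q (Σ_{s ∈ Γ_q} x(π s))² ≤ Λ · μ̄ · Σ_b x_b²` — lengths `|Γ_q| ≤ Λ`, WEIGHTED TRUE MULTIPLICITIES `Σ_q w_q·#{s ∈ Γ_q : π s = b} ≤ μ̄` (no sup over the family)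

Cell `ym3-torus` ∕ fleet seat `ym-ust-19200-p1` (gen 16, route-R E′ lead ∕ namer; NAMER WORD 2 (b) ℓ-power audit + WORD 7 «(H)-REDUCTION» 2026-08-28).  THEOREMS ONLY
(0 `def`, 0 `sorry`); `--supports stmt-QuantumFields-19200`, count-neutral.  YM₃ on T³ is a ladder rung (R3), not the Clay problem; nothing here claims the stub, the crux,
d = 4 or the mass gap.  Pure finite-sum algebra; no lattice letter.

WHY.  Three located bookings of the engine expand a transported quantity along a FAMILY of lattice paths and must sum the squares: (H)-RED-1 («hDir ⟸ hKg-K»: re-basing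
`φ₀(x_q) − R(Γ)φ₀(c_y)` along comb paths), px9's F-H9h″ (the ladder count with TRUE multiplicities instead of the sup weights `(2R+1)^{|t|−i}` — the ℓ-power audit showed the sup
count loses the h-averaging power of `ℓ`), and (P)'s Σ₁ (px17's h-averaged strip combs, `m̄_b ≤ 3ℓ`).  All three need the same real inequality: for a finite family of paths
`Γ_q` (steps `s`, each step sitting on a bond `π s`; repeats allowed), nonnegative path weights `w_q` (e.g. `ℓ′⁻¹` for the offset average), lengths `|Γ_q| ≤ Λ` and the WEIGHTED
MULTIPLICITY `Σ_q w_q·#{s ∈ Γ_q : π s = b} ≤ μ̄` of every bond:  `Σ_q w_q·(Σ_{s∈Γ_q} x(π s))² ≤ Λ·μ̄·Σ_b x_b²`.  Cauchy–Schwarz along each path, then double counting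
(`Finset.sum_fiberwise_of_maps_to`); the multiplicity enters as a FUNCTION bound per bond, never as its sup over the family.

WHAT IS PROVED (ns `…Theorems.Prop7PathMultiplicityCS`): `sum_comp_eq_sum_card_filter_mul` (double counting along one path), ★★ `sum_mul_sq_sum_comp_le` (weighted),
★ `sum_sq_sum_comp_le` (unweighted, `μ̄` = plain multiplicity), `sum_mul_sum_comp_le` (the linear version `Σ_q w_q Σ_{s∈Γ_q} y(π s) ≤ μ̄·Σ_b y_b` for `y ≥ 0`).
HONEST SCOPE.  Finite-sum algebra only; the geometric facts (`Λ ≤ 2R`, `μ̄ ≤ 2R·(R + R²∕ℓ′)` for h-averaged combs, `m̄_b ≤ 3ℓ`) are the consumers'.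

References: T. Bałaban, CMP 98 (1985) 17–51 [Balaban1985Averaging] ((19)–(21) p.21: path families of the averaging operation); CMP 99 (1985) 389–434
[Balaban1985BackgroundPropagators] ((3.3)–(3.4) pp.390–391).
-/

set_option autoImplicit false

open scoped BigOperators

namespace Summit.QuantumFields.YangMills.Theorems.Prop7PathMultiplicityCS

variable {α σ β : Type*} [DecidableEq β]

/-- Double counting along one path: `Σ_{s ∈ Γ} y(π s) = Σ_{b ∈ B} #{s ∈ Γ : π s = b} · y_b` when every step lies on a bond of `B`. [folklore] -/
theorem sum_comp_eq_sum_card_filter_mul (Γ : Finset σ) (π : σ → β) (B : Finset β) (hB : ∀ s ∈ Γ, π s ∈ B) (y : β → ℝ) :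
    ∑ s ∈ Γ, y (π s) = ∑ b ∈ B, ((Γ.filter (fun s => π s = b)).card : ℝ) * y b := by
  rw [← Finset.sum_fiberwise_of_maps_to (s := Γ) (t := B) (g := π) (fun s hs => hB s hs) (f := fun s => y (π s))]
  refine Finset.sum_congr rfl fun b _ => ?_
  rw [Finset.sum_congr rfl (fun s hs => by rw [(Finset.mem_filter.mp hs).2] : ∀ s ∈ Γ.filter (fun s => π s = b), y (π s) = y b),
    Finset.sum_const, nsmul_eq_mul]

/-- The linear version: `Σ_q w_q · Σ_{s∈Γ_q} y(π s) ≤ μ̄ · Σ_b y_b` for `y ≥ 0` on `B`, weights `w ≥ 0`, weighted multiplicities `Σ_q w_q·#{s ∈ Γ_q : π s = b} ≤ μ̄`.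
[cite: Balaban1985Averaging, (19)-(21) p.21] -/
theorem sum_mul_sum_comp_le (Q : Finset α) (Γ : α → Finset σ) (π : σ → β) (B : Finset β)
    (hB : ∀ q ∈ Q, ∀ s ∈ Γ q, π s ∈ B) (w : α → ℝ) (y : β → ℝ) (hy : ∀ b ∈ B, 0 ≤ y b) {μ : ℝ}
    (hμ : ∀ b ∈ B, ∑ q ∈ Q, w q * (((Γ q).filter (fun s => π s = b)).card : ℝ) ≤ μ) :
    ∑ q ∈ Q, w q * ∑ s ∈ Γ q, y (π s) ≤ μ * ∑ b ∈ B, y b := by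
  calc ∑ q ∈ Q, w q * ∑ s ∈ Γ q, y (π s)
      = ∑ q ∈ Q, ∑ b ∈ B, w q * ((((Γ q).filter (fun s => π s = b)).card : ℝ) * y b) := by
        refine Finset.sum_congr rfl fun q hq => ?_
        rw [sum_comp_eq_sum_card_filter_mul (Γ q) π B (hB q hq) y, Finset.mul_sum]
    _ = ∑ b ∈ B, (∑ q ∈ Q, w q * (((Γ q).filter (fun s => π s = b)).card : ℝ)) * y b := by
        rw [Finset.sum_comm]
        refine Finset.sum_congr rfl fun b _ => ?_
        rw [Finset.sum_mul]
        refine Finset.sum_congr rfl fun q _ => ?_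
        ring
    _ ≤ ∑ b ∈ B, μ * y b := Finset.sum_le_sum fun b hb => mul_le_mul_of_nonneg_right (hμ b hb) (hy b hb)
    _ = μ * ∑ b ∈ B, y b := by rw [Finset.mul_sum]

/-- ★★ **PATH-MULTIPLICITY CAUCHY–SCHWARZ, WEIGHTED.**  Finite path family `Γ_q` (steps on bonds `π s ∈ B`, repeats allowed), weights `w_q ≥ 0`, lengths `|Γ_q| ≤ Λ`,
weighted multiplicities `Σ_q w_q·#{s ∈ Γ_q : π s = b} ≤ μ̄`:  `Σ_q w_q·(Σ_{s∈Γ_q} x(π s))² ≤ Λ·μ̄·Σ_{b∈B} x_b²`.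
[cite: Balaban1985Averaging, (19)-(21) p.21; Balaban1985BackgroundPropagators, (3.3)-(3.4) pp.390-391] -/
theorem sum_mul_sq_sum_comp_le (Q : Finset α) (Γ : α → Finset σ) (π : σ → β) (B : Finset β)
    (hB : ∀ q ∈ Q, ∀ s ∈ Γ q, π s ∈ B) (w : α → ℝ) (hw : ∀ q ∈ Q, 0 ≤ w q) (x : β → ℝ) {Λ μ : ℝ} (hΛ0 : 0 ≤ Λ)
    (hΛ : ∀ q ∈ Q, ((Γ q).card : ℝ) ≤ Λ) (hμ : ∀ b ∈ B, ∑ q ∈ Q, w q * (((Γ q).filter (fun s => π s = b)).card : ℝ) ≤ μ) :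
    ∑ q ∈ Q, w q * (∑ s ∈ Γ q, x (π s)) ^ 2 ≤ Λ * μ * ∑ b ∈ B, x b ^ 2 := by
  -- Cauchy–Schwarz along each path
  have hcs : ∀ q ∈ Q, w q * (∑ s ∈ Γ q, x (π s)) ^ 2 ≤ Λ * (w q * ∑ s ∈ Γ q, x (π s) ^ 2) := by
    intro q hq
    have h1 : (∑ s ∈ Γ q, x (π s)) ^ 2 ≤ ((Γ q).card : ℝ) * ∑ s ∈ Γ q, x (π s) ^ 2 := sq_sum_le_card_mul_sum_sq
    have h2 : ((Γ q).card : ℝ) * ∑ s ∈ Γ q, x (π s) ^ 2 ≤ Λ * ∑ s ∈ Γ q, x (π s) ^ 2 :=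
      mul_le_mul_of_nonneg_right (hΛ q hq) (Finset.sum_nonneg fun _ _ => sq_nonneg _)
    have := mul_le_mul_of_nonneg_left (h1.trans h2) (hw q hq)
    linarith [this]
  -- double counting with the weighted multiplicities
  have hlin := sum_mul_sum_comp_le Q Γ π B hB w (fun b => x b ^ 2) (fun b _ => sq_nonneg _) hμ
  calc ∑ q ∈ Q, w q * (∑ s ∈ Γ q, x (π s)) ^ 2
      ≤ ∑ q ∈ Q, Λ * (w q * ∑ s ∈ Γ q, x (π s) ^ 2) := Finset.sum_le_sum hcs
    _ = Λ * ∑ q ∈ Q, w q * ∑ s ∈ Γ q, x (π s) ^ 2 := by rw [Finset.mul_sum]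
    _ ≤ Λ * (μ * ∑ b ∈ B, x b ^ 2) := mul_le_mul_of_nonneg_left hlin hΛ0
    _ = Λ * μ * ∑ b ∈ B, x b ^ 2 := by ring

/-- ★ **PATH-MULTIPLICITY CAUCHY–SCHWARZ, UNWEIGHTED**: lengths `|Γ_q| ≤ Λ`, multiplicities `Σ_q #{s ∈ Γ_q : π s = b} ≤ μ̄`:
`Σ_q (Σ_{s∈Γ_q} x(π s))² ≤ Λ·μ̄·Σ_{b∈B} x_b²`. [cite: Balaban1985Averaging, (19)-(21) p.21] -/
theorem sum_sq_sum_comp_le (Q : Finset α) (Γ : α → Finset σ) (π : σ → β) (B : Finset β)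
    (hB : ∀ q ∈ Q, ∀ s ∈ Γ q, π s ∈ B) (x : β → ℝ) {Λ μ : ℝ} (hΛ0 : 0 ≤ Λ)
    (hΛ : ∀ q ∈ Q, ((Γ q).card : ℝ) ≤ Λ) (hμ : ∀ b ∈ B, ∑ q ∈ Q, (((Γ q).filter (fun s => π s = b)).card : ℝ) ≤ μ) :
    ∑ q ∈ Q, (∑ s ∈ Γ q, x (π s)) ^ 2 ≤ Λ * μ * ∑ b ∈ B, x b ^ 2 := by
  have h := sum_mul_sq_sum_comp_le Q Γ π B hB (fun _ => (1 : ℝ)) (fun _ _ => zero_le_one) x hΛ0 hΛ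
    (fun b hb => by simpa only [one_mul] using hμ b hb)
  simpa only [one_mul] using h

end Summit.QuantumFields.YangMills.Theorems.Prop7PathMultiplicityCS
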